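import Literature.AlgebraicGeometry.Shioda1982.ExceptionalQuadruplesComplete
import HarnessLib

/-!
# Shioda 1982 / Meyer–Neutsch 1981: no exceptional quadruple at the level `N = 440` — kernel sweep, part 5 of 10

Topic `Literature/AlgebraicGeometry/Shioda1982`; companion of `ExceptionalQuadruplesComplete.lean` (search `checkB`, soundness
`tabelleOneCompleteAt_of_chunks`, invariant form `exists_mem_reps_of_isExceptionalQuadruple`, statement `TabelleOneCompleteAt`; sources,
method and framing in its module docstring) and of the series `ExceptionalQuadruplesSweep*.lean` (together: every level `2 ≤ N ≤ 180`
that is not a row of Tabelle 1; `…SweepTwoHundredTwenty/…TwoHundredSixty/…ThreeHundredForty.lean`,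
`…SweepTwoHundredFiftyTwo/…ThreeHundredNinetySix/…FourHundredSixtyEight.lean`, `…SweepTwoHundred.lean`: the levels `220, 260, 340`, `252, 396, 468`
and `200` of the families `20p`, `36p`, `40p`). THEOREMS only (no definition, no named fact): the same kernel
search at the single level `N = 440`, which carries NO row of [MeyerNeutsch1981Fermatquadrupel, Tabelle 1] (computer-generated there,
"alle Fermatquadrupel für N ≤ 614 ermittelt", §2 p. 53) and lies above the range `N ≤ 180` of Shioda's table p. 727 — by Aoki's
Theorem C ([Aoki1983], computer-assisted for `181 ≤ m ≤ 672`) there is no exceptional element at any level `> 180`; the files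
`ExceptionalQuadruplesSweepFourHundredFortyPartOne.lean`, `ExceptionalQuadruplesSweepFourHundredFortyPartTwo.lean`, `ExceptionalQuadruplesSweepFourHundredFortyPartThree.lean`, `ExceptionalQuadruplesSweepFourHundredFortyPartFour.lean`, `ExceptionalQuadruplesSweepFourHundredFortyPartFive.lean`, `ExceptionalQuadruplesSweepFourHundredFortyPartSix.lean`, `ExceptionalQuadruplesSweepFourHundredFortyPartSeven.lean`, `ExceptionalQuadruplesSweepFourHundredFortyPartEight.lean`, `ExceptionalQuadruplesSweepFourHundredFortyPartNine.lean`, `ExceptionalQuadruplesSweepFourHundredForty.lean` make the instance `N = 440` a kernel statement. The search at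
`N = 440` visits 2390459 candidate triples (`φ(440) − 1 = 159` units each), too many for one elaboration of bounded wall time, so the
chunks of first entries are spread over 10 files: `ExceptionalQuadruplesSweepFourHundredFortyPartOne.lean` — first entries `0 ≤ a < 14` (231879 candidates);
`ExceptionalQuadruplesSweepFourHundredFortyPartTwo.lean` — first entries `14 ≤ a < 28` (241597 candidates);
`ExceptionalQuadruplesSweepFourHundredFortyPartThree.lean` — first entries `28 ≤ a < 41` (228645 candidates);
`ExceptionalQuadruplesSweepFourHundredFortyPartFour.lean` — first entries `41 ≤ a < 55` (246133 candidates);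
`ExceptionalQuadruplesSweepFourHundredFortyPartFive.lean` — first entries `55 ≤ a < 69` (241119 candidates);
`ExceptionalQuadruplesSweepFourHundredFortyPartSix.lean` — first entries `69 ≤ a < 83` (231074 candidates);
`ExceptionalQuadruplesSweepFourHundredFortyPartSeven.lean` — first entries `83 ≤ a < 99` (245331 candidates);
`ExceptionalQuadruplesSweepFourHundredFortyPartEight.lean` — first entries `99 ≤ a < 117` (243111 candidates);
`ExceptionalQuadruplesSweepFourHundredFortyPartNine.lean` — first entries `117 ≤ a < 138` (225856 candidates);
`ExceptionalQuadruplesSweepFourHundredForty.lean` — first entries `138 ≤ a < 440` (255714 candidates); the last one assembles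
`completeAt_fourHundredForty` (every sorted pair-free primitive Hodge 4-multiset mod `440` is standard) and `not_isExceptionalQuadruple_fourHundredForty`.
WHY THIS LEVEL (cell `pub-hfermat`): `440 = 40·11`, the instance `p = 11` of the family `m = 40p` of
`HodgeQuadruplesFortyPrime.lean` (`classify_hodgeMultiset_fortyPrime`, `p ≥ 19`) below its range — a residual prime of the
companion `PicardNumberFortyPrime.lean` (`exceptional_fortyPrime`). `decide +kernel` only (no `native_decide`).

HONEST FRAMING (cell `pub-hfermat`): explicit algebraic cycles for specific Hodge classes on Fermat/Delsarte varieties; residual open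
instances listed; no claim on general Hodge. These classes are algebraic (Lefschetz (1,1)); certified here is only the emptiness of the
exceptional list at this level.

## References
* [MeyerNeutsch1981Fermatquadrupel] W. Meyer, W. Neutsch, *Fermatquadrupel*, Math. Ann. 256 (1981) 51–62, §2 p. 53, Tabelle 1 p. 54 (no row 440).
* [Shioda1982PicardFermat] T. Shioda, J. Fac. Sci. Univ. Tokyo IA 28 (1982) 725–734, table p. 727 (levels `≤ 180`), Prop. 4 (Q′) p. 729.
* [Aoki1983] N. Aoki, Math. Ann. 266 (1983) 23–54, Thm. C.
-/

namespace Literature.AlgebraicGeometry.Shioda1982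

open Literature.AlgebraicGeometry.HodgeTheory

set_option maxHeartbeats 0 in
/-- **The search at `N = 440` passes on the first entries `55 ≤ a < 69`** (part 5 of 10: 14 chunks, 241119 candidate
triples): every visited sorted quadruple of representatives there fails the Hodge test or is standard (`checkB`; `reps 440 = []`).
[cite: MeyerNeutsch1981Fermatquadrupel, §2 p. 53 ("alle Fermatquadrupel für N ≤ 614 ermittelt") and Tabelle 1 p. 54 (no row 440)]
[cite: Aoki1983, Thm. C] -/
theorem checkB_fourHundredForty_partFive :
    ∀ p ∈ ([(55, 1), (56, 1), (57, 1), (58, 1), (59, 1), (60, 1), (61, 1), (62, 1), (63, 1), (64, 1), (65, 1), (66, 1), (67, 1), (68, 1)] : List (ℕ × ℕ)), checkB 440 p.1 p.2 = true := by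
  intro p hp
  simp only [List.mem_cons, List.not_mem_nil, or_false] at hp
  rcases hp with rfl | rfl | rfl | rfl | rfl | rfl | rfl | rfl | rfl | rfl | rfl | rfl | rfl | rfl <;> decide +kernel

end Literature.AlgebraicGeometry.Shioda1982
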